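import Mathlib.LinearAlgebra.Pi
import Mathlib.LinearAlgebra.Prod
import Mathlib.Algebra.BigOperators.Fin
import Mathlib.Tactic.Ring
import HarnessLib

/-!
# The Betina–Dimitrov weight-one CM Hecke algebras in coordinates — cases (gen)/(B)
# (ring structure for the kernel Lemma T of `CMBranchDualReductionCaseC.lean` / `…CaseB.lean`)

Pure commutative algebra, sorry-free, no facts. See the module docstring of `CMBranchDualReductionCaseC.lean`
for the context (BSTW Prop. 4.12 `Sat-prop2` repair, reader 1's Lemma S + Lemma T, referee C4 ROUND C4-R3 (ε)).

THE RING (printed). Betina–Dimitrov, Adv. Math. 384 (2021) 107724 = arXiv:1907.09422, Thm. 2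
[corpus:paper:arxiv-1907.09422 p0003:L60–p0004:L3] / Thm. 4.8(i) [p0021:L68–L72]: for `r = 2`,
`𝒯 = Λ_𝔭 ×_k ℛ^⊥ ×_k ℛ^⊥ ×_k Λ_𝔭` with `ℛ^⊥ = k⟦Y⟧ ≅ k⟦X^{1/e}⟧` a DVR of ramification index `e ≥ 1`
over `Λ = k⟦X⟧` [p0016:L16] (`e = 1`: the generic case `𝒯^⊥ = Λ ×_k Λ`; `e ≥ 2`: case (B)); all four
factors glued along their common residue field `k`; the two outer factors are the CM components.
HERE: over an ARBITRARY commutative ring `Λ` with a distinguished element `X`, and with INDEPENDENT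
ramification indices `e₂ = n₂ + 1`, `e₃ = n₃ + 1 ≥ 1` for the two non-CM factors (more general than print,
where `e₂ = e₃`). As a `Λ`-module `𝒯 = Λ·1 ⊕ 𝔪₂ ⊕ 𝔪₃ ⊕ Λ·m₄` (`𝔪ᵢ = Y_i·k⟦Y_i⟧` with `Λ`-basis
`Y_i, …, Y_i^{e_i}`, `m₄ = (0,0,0,X)`; reader 1 ADD-5 §2), i.e. coordinates
`V Λ n₂ n₃ = Λ × (Fin e₂ → Λ) × (Fin e₃ → Λ) × Λ`, `(c; a; b; d) ↔ (c, c + Σ aᵢY₂^{i+1}, c + Σ bⱼY₃^{j+1}, c + dX)`.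
Multiplication: `shift` = multiplication by `Y` on `𝔪` (`Y·Y^j = Y^{j+1}`, `Y·Y^e = X·Y` since `Y^e = X`),
`bmulL a = Σ aᵢ • shift^{i+1}` = multiplication by `Σ aᵢ Y^{i+1}` on `𝔪`, and
`mulLeft (c;a;b;d) (c';a';b';d') = (cc'; c a' + c' a + a ⋆ a'; c b' + c' b + b ⋆ b'; cd' + c'd + X dd')`.
Certification lemmas: `one_mulLeft`/`mulLeft_one` (unit), `mulLeft_y₂_y₂'` (`Y₂^{i+1}·Y₂^{j+1} =
shift^{i+j+1} Y₂`, symmetric in `i, j`), `shift_pow_single_zero` (`shift^j Y = Y^{j+1}`), `shift_single_last`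
(`Y·Y^e = X·Y`), `shift_pow_card_apply_single` (`Y^e · _ = X • _`), cross products `Y₂·Y₃ = Y₂·m₄ = 0`,
`mulLeft_m₄` (`m₄·(c;…;d') = (c' + Xd')·m₄`), bilinearity `mulLeft_add`/`mulLeft_smul`; `pr₁ = c` and
(`…CaseB.lean`) `pr₄ = c + Xd` are the two CM projections. What stays on paper: that BD's completed local
ring is this algebra [cite: BetinaDimitrov2021, Thm 2 / Thm 4.8]. No modular forms here.
-/

namespace Literature.NumberTheory.EllipticCurves.IwasawaTransfer

open Module
/-! ### Cases (gen)/(B) of [BD, Thm 2 / Thm 4.8]: `𝒯 = Λ ×_k k⟦Y₂⟧ ×_k k⟦Y₃⟧ ×_k Λ`, `Y_i^(e_i) = X` -/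

namespace BDRingB

section Block

variable {Λ : Type*} [CommRing Λ] (X : Λ) (n : ℕ)

/-- Multiplication by `Y` on `𝔪 = Y·k⟦Y⟧`, in the `Λ`-basis `Y, Y², …, Y^e` (`e = n + 1`, `Y^e = X`;
coordinate `i : Fin (n+1)` ↔ `Y^(i+1)`): `Y·Y^(j+1) = Y^(j+2)` for `j < n` and `Y·Y^e = X·Y`.
[cite: BetinaDimitrov2021, Thm 2 (= Thm 4.8 (i)), cases r = 2] -/
def shift : (Fin (n + 1) → Λ) →ₗ[Λ] (Fin (n + 1) → Λ) where
  toFun a := Fin.cons (X * a (Fin.last n)) (fun i => a (Fin.castSucc i))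
  map_add' a b := by
    ext i
    refine Fin.cases ?_ (fun j => ?_) i
    · simp [mul_add]
    · simp
  map_smul' c a := by
    ext i
    refine Fin.cases ?_ (fun j => ?_) i
    · simp [mul_left_comm]
    · simp

/-- `(Y·a)_1 = X a_e`. [cite: BetinaDimitrov2021, Thm 2 (= Thm 4.8 (i)), cases r = 2] -/
@[simp] theorem shift_apply_zero (a : Fin (n + 1) → Λ) : shift X n a 0 = X * a (Fin.last n) := by
  simp [shift]

/-- `(Y·a)_{j+2} = a_{j+1}`. [cite: BetinaDimitrov2021, Thm 2 (= Thm 4.8 (i)), cases r = 2] -/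
@[simp] theorem shift_apply_succ (a : Fin (n + 1) → Λ) (j : Fin n) :
    shift X n a j.succ = a (Fin.castSucc j) := by
  simp [shift]

/-- `Y · Y^(i+1) = Y^(i+2)` for `i + 1 < e`. [cite: BetinaDimitrov2021, Thm 2 (= Thm 4.8 (i)), cases r = 2] -/
theorem shift_single_castSucc (i : Fin n) :
    shift X n (Pi.single (Fin.castSucc i) 1) = Pi.single i.succ 1 := by
  ext j
  refine Fin.cases ?_ (fun j' => ?_) j
  · rw [shift_apply_zero, Pi.single_apply, if_neg (Fin.castSucc_lt_last i).ne', mul_zero,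
      Pi.single_apply, if_neg (Fin.succ_ne_zero i).symm]
  · rw [shift_apply_succ, Pi.single_apply, Pi.single_apply]
    simp only [Fin.castSucc_inj, Fin.succ_inj]

/-- `Y · Y^e = X · Y`. [cite: BetinaDimitrov2021, Thm 2 (= Thm 4.8 (i)), cases r = 2] -/
theorem shift_single_last : shift X n (Pi.single (Fin.last n) 1) = X • Pi.single 0 1 := by
  ext j
  refine Fin.cases ?_ (fun j' => ?_) j
  · simp
  · rw [shift_apply_succ, Pi.single_apply, if_neg (Fin.castSucc_lt_last j').ne, Pi.smul_apply,
      Pi.single_apply, if_neg (Fin.succ_ne_zero j'), smul_zero]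

/-- `Y^j · Y = Y^(j+1)`: the `j`-th iterate of `shift` on `Y`.
[cite: BetinaDimitrov2021, Thm 2 (= Thm 4.8 (i)), cases r = 2] -/
theorem shift_pow_single_zero (i : Fin (n + 1)) :
    ((shift X n) ^ (i : ℕ)) (Pi.single 0 1) = Pi.single i 1 := by
  suffices h : ∀ k (hk : k < n + 1), ((shift X n) ^ k) (Pi.single 0 1) = Pi.single (⟨k, hk⟩ : Fin (n+1)) 1 by
    exact h i i.isLt
  intro k
  induction k with
  | zero => intro hk; simp
  | succ k ih =>
    intro hk
    have hk' : k < n := Nat.lt_of_succ_lt_succ hk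
    rw [pow_succ', Module.End.mul_apply, ih (Nat.lt_of_lt_of_le hk' (Nat.le_succ n))]
    have : (⟨k, Nat.lt_of_lt_of_le hk' (Nat.le_succ n)⟩ : Fin (n + 1)) = Fin.castSucc ⟨k, hk'⟩ := rfl
    rw [this, shift_single_castSucc]
    rfl

/-- `Y^(i+1) · Y^e = X · Y^(i+1)`. [cite: BetinaDimitrov2021, Thm 2 (= Thm 4.8 (i)), cases r = 2] -/
theorem shift_pow_succ_single_last (i : Fin (n + 1)) :
    ((shift X n) ^ ((i : ℕ) + 1)) (Pi.single (Fin.last n) 1) = X • Pi.single i 1 := by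
  rw [pow_succ, Module.End.mul_apply, shift_single_last, map_smul, shift_pow_single_zero]

/-- The product `a ⋆ a'` of `𝔪 = Y·k⟦Y⟧`, as a linear map in `a'`:
`(Σᵢ aᵢ Y^(i+1)) ⋆ a' = Σᵢ aᵢ • shift^(i+1) a'`. [cite: BetinaDimitrov2021, Thm 2 (= Thm 4.8 (i)), cases r = 2] -/
def bmulL (a : Fin (n + 1) → Λ) : (Fin (n + 1) → Λ) →ₗ[Λ] (Fin (n + 1) → Λ) :=
  ∑ i : Fin (n + 1), a i • (shift X n) ^ ((i : ℕ) + 1)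

/-- Unfolding `bmulL`. [cite: BetinaDimitrov2021, Thm 2 (= Thm 4.8 (i)), cases r = 2] -/
theorem bmulL_apply (a a' : Fin (n + 1) → Λ) :
    bmulL X n a a' = ∑ i : Fin (n + 1), a i • ((shift X n) ^ ((i : ℕ) + 1)) a' := by
  simp [bmulL, LinearMap.sum_apply, LinearMap.smul_apply]

/-- `0 ⋆ a' = 0`. [cite: BetinaDimitrov2021, Thm 2 (= Thm 4.8 (i)), cases r = 2] -/
@[simp] theorem bmulL_zero_left : bmulL X n 0 = 0 := by
  simp [bmulL]

/-- `⋆` is additive in the left factor. [cite: BetinaDimitrov2021, Thm 2 (= Thm 4.8 (i)), cases r = 2] -/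
theorem bmulL_add_left (a a' : Fin (n + 1) → Λ) : bmulL X n (a + a') = bmulL X n a + bmulL X n a' := by
  simp [bmulL, add_smul, Finset.sum_add_distrib]

/-- `⋆` is `Λ`-homogeneous in the left factor. [cite: BetinaDimitrov2021, Thm 2 (= Thm 4.8 (i)), cases r = 2] -/
theorem bmulL_smul_left (c : Λ) (a : Fin (n + 1) → Λ) : bmulL X n (c • a) = c • bmulL X n a := by
  simp [bmulL, Finset.smul_sum, smul_smul]

/-- `Y ⋆ a' = shift a'`. [cite: BetinaDimitrov2021, Thm 2 (= Thm 4.8 (i)), cases r = 2] -/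
theorem bmulL_single_zero_left (a' : Fin (n + 1) → Λ) : bmulL X n (Pi.single 0 1) a' = shift X n a' := by
  rw [bmulL_apply, Fin.sum_univ_succ]
  simp [Fin.succ_ne_zero]

/-- `a ⋆ Y^e = X • a` (`Y^e = X`). [cite: BetinaDimitrov2021, Thm 2 (= Thm 4.8 (i)), cases r = 2] -/
theorem bmulL_single_last (a : Fin (n + 1) → Λ) : bmulL X n a (Pi.single (Fin.last n) 1) = X • a := by
  rw [bmulL_apply]
  simp_rw [shift_pow_succ_single_last]
  ext j
  simp [Finset.sum_apply, Pi.single_apply, mul_comm]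

end Block

section Ring

variable {Λ : Type*} [CommRing Λ] (X : Λ) (n₂ n₃ : ℕ)

/-- Coordinates of `𝒯 = Λ ×_k k⟦Y₂⟧ ×_k k⟦Y₃⟧ ×_k Λ` (`Y_i^(e_i) = X`, `e_i = n_i + 1`) w.r.t. the
decomposition `𝒯 = Λ·1 ⊕ 𝔪₂ ⊕ 𝔪₃ ⊕ Λ·m₄`: `(c; a; b; d) ↔ c·1 + Σ aᵢ Y₂^(i+1) + Σ bⱼ Y₃^(j+1) + d·m₄`,
`m₄ = (0, 0, 0, X)`, i.e. the element `(c, c + Σ aᵢY₂^(i+1), c + Σ bⱼY₃^(j+1), c + dX)` of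
`Λ × k⟦Y₂⟧ × k⟦Y₃⟧ × Λ`. [cite: BetinaDimitrov2021, Thm 2 (= Thm 4.8 (i)), cases r = 2] -/
abbrev V (Λ : Type*) [CommRing Λ] (n₂ n₃ : ℕ) := Λ × (Fin (n₂ + 1) → Λ) × (Fin (n₃ + 1) → Λ) × Λ

/-- Projection to the `𝔪₂`-block. [folklore] -/
def blkA : V Λ n₂ n₃ →ₗ[Λ] (Fin (n₂ + 1) → Λ) := LinearMap.fst Λ _ _ ∘ₗ LinearMap.snd Λ Λ _
/-- Projection to the `𝔪₃`-block. [folklore] -/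
def blkB : V Λ n₂ n₃ →ₗ[Λ] (Fin (n₃ + 1) → Λ) :=
  LinearMap.fst Λ _ _ ∘ₗ LinearMap.snd Λ _ _ ∘ₗ LinearMap.snd Λ Λ _
/-- The last coordinate `d`. [folklore] -/
def lst : V Λ n₂ n₃ →ₗ[Λ] Λ := LinearMap.snd Λ _ _ ∘ₗ LinearMap.snd Λ _ _ ∘ₗ LinearMap.snd Λ Λ _
/-- The first coordinate `c` (= the projection `π_ψ` onto the FIRST factor `Λ`).
[cite: BetinaDimitrov2021, Thm 2 (= Thm 4.8 (i)), cases r = 2] -/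
def pr₁ : V Λ n₂ n₃ →ₗ[Λ] Λ := LinearMap.fst Λ Λ _

/-- Unfolding `blkA`. [cite: BetinaDimitrov2021, Thm 2 (= Thm 4.8 (i)), cases r = 2] -/
@[simp] theorem blkA_apply (v : V Λ n₂ n₃) : blkA n₂ n₃ v = v.2.1 := rfl
/-- Unfolding `blkB`. [cite: BetinaDimitrov2021, Thm 2 (= Thm 4.8 (i)), cases r = 2] -/
@[simp] theorem blkB_apply (v : V Λ n₂ n₃) : blkB n₂ n₃ v = v.2.2.1 := rfl
/-- Unfolding `lst`. [cite: BetinaDimitrov2021, Thm 2 (= Thm 4.8 (i)), cases r = 2] -/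
@[simp] theorem lst_apply (v : V Λ n₂ n₃) : lst n₂ n₃ v = v.2.2.2 := rfl
/-- Unfolding `pr₁`. [cite: BetinaDimitrov2021, Thm 2 (= Thm 4.8 (i)), cases r = 2] -/
@[simp] theorem pr₁_apply (v : V Λ n₂ n₃) : pr₁ n₂ n₃ v = v.1 := rfl

/-- Left multiplication by `t = (c; a; b; d)`:
`t · (c'; a'; b'; d') = (cc'; c•a' + c'•a + a ⋆ a'; c•b' + c'•b + b ⋆ b'; cd' + c'd + X dd')`.
[cite: BetinaDimitrov2021, Thm 2 (= Thm 4.8), cases `r = 2`: `𝒯^⊥ = ℛ^⊥ ×_k ℛ^⊥`, `ℛ^⊥ ≅ Q̄_p⟦X^{1/e}⟧`] -/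
def mulLeft (t : V Λ n₂ n₃) : V Λ n₂ n₃ →ₗ[Λ] V Λ n₂ n₃ :=
  (t.1 • pr₁ n₂ n₃).prod
    ((t.1 • blkA n₂ n₃ + (pr₁ n₂ n₃).smulRight t.2.1 + bmulL X n₂ t.2.1 ∘ₗ blkA n₂ n₃).prod
      ((t.1 • blkB n₂ n₃ + (pr₁ n₂ n₃).smulRight t.2.2.1 + bmulL X n₃ t.2.2.1 ∘ₗ blkB n₂ n₃).prod
        (t.1 • lst n₂ n₃ + t.2.2.2 • pr₁ n₂ n₃ + (X * t.2.2.2) • lst n₂ n₃)))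

/-- Unfolding `mulLeft`. [cite: BetinaDimitrov2021, Thm 2 (= Thm 4.8 (i)), cases r = 2] -/
theorem mulLeft_apply (t v : V Λ n₂ n₃) : mulLeft X n₂ n₃ t v =
    (t.1 * v.1, t.1 • v.2.1 + v.1 • t.2.1 + bmulL X n₂ t.2.1 v.2.1,
      t.1 • v.2.2.1 + v.1 • t.2.2.1 + bmulL X n₃ t.2.2.1 v.2.2.1,
      t.1 * v.2.2.2 + t.2.2.2 * v.1 + X * t.2.2.2 * v.2.2.2) := rfl

/-- The unit `1 = (1; 0; 0; 0)`. [cite: BetinaDimitrov2021, Thm 2 (= Thm 4.8 (i)), cases r = 2] -/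
def one : V Λ n₂ n₃ := (1, 0, 0, 0)
/-- `Y₂^(i+1) = (0; δᵢ; 0; 0)`. [cite: BetinaDimitrov2021, Thm 2 (= Thm 4.8 (i)), cases r = 2] -/
def y₂ (i : Fin (n₂ + 1)) : V Λ n₂ n₃ := (0, Pi.single i 1, 0, 0)
/-- `Y₃^(j+1) = (0; 0; δⱼ; 0)`. [cite: BetinaDimitrov2021, Thm 2 (= Thm 4.8 (i)), cases r = 2] -/
def y₃ (j : Fin (n₃ + 1)) : V Λ n₂ n₃ := (0, 0, Pi.single j 1, 0)
/-- `m₄ = (0; 0; 0; 1)` (the element `(0, 0, 0, X)` of the ambient product).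
[cite: BetinaDimitrov2021, Thm 2 (= Thm 4.8 (i)), cases r = 2] -/
def m₄ : V Λ n₂ n₃ := (0, 0, 0, 1)

/-- `t · 1 = t`. [cite: BetinaDimitrov2021, Thm 2 (= Thm 4.8 (i)), cases r = 2] -/
theorem mulLeft_one (t : V Λ n₂ n₃) : mulLeft X n₂ n₃ t (one n₂ n₃) = t := by
  obtain ⟨c, a, b, d⟩ := t
  simp [mulLeft_apply, one]

/-- `1 · v = v`. [cite: BetinaDimitrov2021, Thm 2 (= Thm 4.8 (i)), cases r = 2] -/
theorem one_mulLeft (v : V Λ n₂ n₃) : mulLeft X n₂ n₃ (one n₂ n₃) v = v := by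
  obtain ⟨c, a, b, d⟩ := v
  simp [mulLeft_apply, one]

/-- Left multiplication is additive in `t`. [cite: BetinaDimitrov2021, Thm 2 (= Thm 4.8 (i)), cases r = 2] -/
theorem mulLeft_add (s t : V Λ n₂ n₃) : mulLeft X n₂ n₃ (s + t) = mulLeft X n₂ n₃ s + mulLeft X n₂ n₃ t := by
  refine LinearMap.ext fun v => ?_
  simp only [mulLeft_apply, LinearMap.add_apply, Prod.fst_add, Prod.snd_add, bmulL_add_left,
    Prod.mk_add_mk]
  ext <;> simp <;> ring

/-- Left multiplication is `Λ`-homogeneous in `t`. [cite: BetinaDimitrov2021, Thm 2 (= Thm 4.8 (i)), cases r = 2] -/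
theorem mulLeft_smul (c : Λ) (t : V Λ n₂ n₃) : mulLeft X n₂ n₃ (c • t) = c • mulLeft X n₂ n₃ t := by
  refine LinearMap.ext fun v => ?_
  simp only [mulLeft_apply, LinearMap.smul_apply, Prod.smul_fst, Prod.smul_snd, smul_eq_mul,
    bmulL_smul_left, Prod.smul_mk]
  ext <;> simp <;> ring

/-- `Y₂^(i+1) · Y₂^(j+1) = shift₂^(i+1) (Y₂^(j+1))` and the cross products `Y₂·Y₃ = Y₂·m₄ = 0`.
[cite: BetinaDimitrov2021, Thm 2 (= Thm 4.8 (i)), cases r = 2] -/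
theorem mulLeft_y₂_y₂ (i j : Fin (n₂ + 1)) : mulLeft X n₂ n₃ (y₂ n₂ n₃ i) (y₂ n₂ n₃ j) =
    (0, ((shift X n₂) ^ ((i : ℕ) + 1)) (Pi.single j 1), 0, 0) := by
  simp [mulLeft_apply, y₂, bmulL_apply, Pi.single_apply, Finset.sum_ite_eq']

/-- `Y₂^(i+1) · Y₂^(j+1) = shift₂^(i+j+1) Y₂` — visibly symmetric in `i, j` (commutativity on the basis);
with `shift_pow_single_zero`/`shift_single_last` this is `Y₂^(i+j+2)` reduced via `Y₂^(e₂) = X`.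
[cite: BetinaDimitrov2021, Thm 2 (= Thm 4.8 (i)), cases r = 2] -/
theorem mulLeft_y₂_y₂' (i j : Fin (n₂ + 1)) : mulLeft X n₂ n₃ (y₂ n₂ n₃ i) (y₂ n₂ n₃ j) =
    (0, ((shift X n₂) ^ ((i : ℕ) + (j : ℕ) + 1)) (Pi.single 0 1), 0, 0) := by
  rw [mulLeft_y₂_y₂, ← shift_pow_single_zero X n₂ j, ← Module.End.mul_apply, ← pow_add, Nat.add_right_comm]

/-- `t · m₄ = (c + X d) m₄`. [cite: BetinaDimitrov2021, Thm 2 (= Thm 4.8 (i)), cases r = 2] -/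
theorem mulLeft_m₄ (t : V Λ n₂ n₃) : mulLeft X n₂ n₃ t (m₄ n₂ n₃) = (0, 0, 0, t.1 + X * t.2.2.2) := by
  simp [mulLeft_apply, m₄]

/-- `t · Y₂^(i+1)`. [cite: BetinaDimitrov2021, Thm 2 (= Thm 4.8 (i)), cases r = 2] -/
theorem mulLeft_y₂ (t : V Λ n₂ n₃) (i : Fin (n₂ + 1)) :
    mulLeft X n₂ n₃ t (y₂ n₂ n₃ i) = (0, t.1 • Pi.single i 1 + bmulL X n₂ t.2.1 (Pi.single i 1), 0, 0) := by
  simp [mulLeft_apply, y₂]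

/-- `t · Y₃^(j+1)`. [cite: BetinaDimitrov2021, Thm 2 (= Thm 4.8 (i)), cases r = 2] -/
theorem mulLeft_y₃ (t : V Λ n₂ n₃) (j : Fin (n₃ + 1)) :
    mulLeft X n₂ n₃ t (y₃ n₂ n₃ j) = (0, 0, t.1 • Pi.single j 1 + bmulL X n₃ t.2.2.1 (Pi.single j 1), 0) := by
  simp [mulLeft_apply, y₃]

end Ring


section MoreBlock

variable {Λ : Type*} [CommRing Λ] (X : Λ) (n : ℕ)

/-- `Y^e · a = X • a` on `𝔪`: `shift^e = X • id` (`e = n + 1`).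
[cite: BetinaDimitrov2021, Thm 2 (= Thm 4.8 (i)), cases r = 2] -/
theorem shift_pow_card_apply_single (i : Fin (n + 1)) :
    ((shift X n) ^ (n + 1)) (Pi.single i 1) = X • Pi.single i 1 := by
  have hlast : ((shift X n) ^ n) (Pi.single 0 1) = Pi.single (Fin.last n) 1 := by
    simpa using shift_pow_single_zero X n (Fin.last n)
  have h0 : ((shift X n) ^ (n + 1)) (Pi.single 0 1) = X • Pi.single 0 1 := by
    rw [pow_succ', Module.End.mul_apply, hlast, shift_single_last]
  calc ((shift X n) ^ (n + 1)) (Pi.single i 1)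
      = ((shift X n) ^ (n + 1)) (((shift X n) ^ (i : ℕ)) (Pi.single 0 1)) := by
        rw [shift_pow_single_zero]
    _ = ((shift X n) ^ (i : ℕ)) (((shift X n) ^ (n + 1)) (Pi.single 0 1)) := by
        rw [← Module.End.mul_apply, ← Module.End.mul_apply, pow_mul_comm]
    _ = X • Pi.single i 1 := by rw [h0, map_smul, shift_pow_single_zero]

/-- `Y^e ⋆ a' = X • a'`. [cite: BetinaDimitrov2021, Thm 2 (= Thm 4.8 (i)), cases r = 2] -/
theorem bmulL_single_last_left (a' : Fin (n + 1) → Λ) :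
    bmulL X n (Pi.single (Fin.last n) 1) a' = X • a' := by
  have key : ((shift X n) ^ (n + 1)) a' = X • a' := by
    have : ((shift X n) ^ (n + 1)) = X • (1 : Module.End Λ (Fin (n + 1) → Λ)) := by
      refine LinearMap.pi_ext' fun i => LinearMap.ext_ring ?_
      simpa using shift_pow_card_apply_single X n i
    rw [this, LinearMap.smul_apply, Module.End.one_apply]
  rw [bmulL_apply, Fin.sum_univ_castSucc]
  simp [(Fin.castSucc_lt_last _).ne, key]

end MoreBlock

section RingEval

variable {Λ : Type*} [CommRing Λ] (X : Λ) (n₂ n₃ : ℕ)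

/-- `vec₃ = -X·1 + Y₂^(e₂) + Y₃^(e₃) + m₄`; it annihilates `𝔭 = ker π_ψ` and lies in the other CM branch's
kernel `𝔭'`.
[cite: BurungaleSkinnerTianWan2024, Part I Prop. 4.12 (proof l.3385–3388 `Sat-prop2`: repair step Lemma T = r1 ADD-5 §2; PREPRINT)] -/
def vec₃ : V Λ n₂ n₃ := (-X, Pi.single (Fin.last n₂) 1, Pi.single (Fin.last n₃) 1, 1)

/-- `vec₃ = -X·1 + Y₂^(e₂) + Y₃^(e₃) + m₄`. [cite: BetinaDimitrov2021, Thm 2 (= Thm 4.8 (i)), cases r = 2] -/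
theorem vec₃_eq : vec₃ X n₂ n₃ =
    -X • one n₂ n₃ + y₂ n₂ n₃ (Fin.last n₂) + y₃ n₂ n₃ (Fin.last n₃) + m₄ n₂ n₃ := by
  ext <;> simp [vec₃, one, y₂, y₃, m₄]

/-- `t · Y₂^(e₂) = c•Y₂^(e₂) + X•a`. [cite: BetinaDimitrov2021, Thm 2 (= Thm 4.8 (i)), cases r = 2] -/
theorem mulLeft_y₂_last (t : V Λ n₂ n₃) : mulLeft X n₂ n₃ t (y₂ n₂ n₃ (Fin.last n₂)) =
    (0, t.1 • Pi.single (Fin.last n₂) 1 + X • t.2.1, 0, 0) := by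
  rw [mulLeft_y₂, bmulL_single_last]

/-- `t · Y₃^(e₃) = c•Y₃^(e₃) + X•b`. [cite: BetinaDimitrov2021, Thm 2 (= Thm 4.8 (i)), cases r = 2] -/
theorem mulLeft_y₃_last (t : V Λ n₂ n₃) : mulLeft X n₂ n₃ t (y₃ n₂ n₃ (Fin.last n₃)) =
    (0, 0, t.1 • Pi.single (Fin.last n₃) 1 + X • t.2.2.1, 0) := by
  rw [mulLeft_y₃, bmulL_single_last]

/-- `vec₃` annihilates `𝔭 = ker pr₁`. [cite: BetinaDimitrov2021, Thm 2 (= Thm 4.8 (i)), cases r = 2] -/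
theorem mulLeft_vec₃ (t : V Λ n₂ n₃) (ht : t.1 = 0) : mulLeft X n₂ n₃ t (vec₃ X n₂ n₃) = 0 := by
  obtain ⟨c, a, b, d⟩ := t
  change c = 0 at ht
  subst ht
  rw [mulLeft_apply, vec₃]
  simp only [bmulL_single_last, zero_mul, zero_smul, zero_add, neg_smul, neg_add_cancel, mul_neg,
    mul_one]
  ext <;> simp [mul_comm]

/-- `Y₂ · Y₂^(i+1)`: `shift`. [cite: BetinaDimitrov2021, Thm 2 (= Thm 4.8 (i)), cases r = 2] -/
theorem mulLeft_y₂_zero_y₂ (i : Fin (n₂ + 1)) :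
    mulLeft X n₂ n₃ (y₂ n₂ n₃ 0) (y₂ n₂ n₃ i) = (0, shift X n₂ (Pi.single i 1), 0, 0) := by
  rw [mulLeft_y₂, y₂]
  simp [bmulL_single_zero_left]

/-- `Y₃ · Y₃^(j+1)`: `shift`. [cite: BetinaDimitrov2021, Thm 2 (= Thm 4.8 (i)), cases r = 2] -/
theorem mulLeft_y₃_zero_y₃ (j : Fin (n₃ + 1)) :
    mulLeft X n₂ n₃ (y₃ n₂ n₃ 0) (y₃ n₂ n₃ j) = (0, 0, shift X n₃ (Pi.single j 1), 0) := by
  rw [mulLeft_y₃, y₃]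
  simp [bmulL_single_zero_left]

/-- `Y₂ · Y₃^(j+1) = 0`. [cite: BetinaDimitrov2021, Thm 2 (= Thm 4.8 (i)), cases r = 2] -/
theorem mulLeft_y₂_zero_y₃ (j : Fin (n₃ + 1)) : mulLeft X n₂ n₃ (y₂ n₂ n₃ 0) (y₃ n₂ n₃ j) = 0 := by
  rw [mulLeft_y₃, y₂]; simp

/-- `Y₃ · Y₂^(i+1) = 0`. [cite: BetinaDimitrov2021, Thm 2 (= Thm 4.8 (i)), cases r = 2] -/
theorem mulLeft_y₃_zero_y₂ (i : Fin (n₂ + 1)) : mulLeft X n₂ n₃ (y₃ n₂ n₃ 0) (y₂ n₂ n₃ i) = 0 := by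
  rw [mulLeft_y₂, y₃]; simp

/-- `m₄ · Y₂^(i+1) = 0`. [cite: BetinaDimitrov2021, Thm 2 (= Thm 4.8 (i)), cases r = 2] -/
theorem mulLeft_m₄_y₂ (i : Fin (n₂ + 1)) : mulLeft X n₂ n₃ (m₄ n₂ n₃) (y₂ n₂ n₃ i) = 0 := by
  rw [mulLeft_y₂, m₄]; simp

/-- `m₄ · Y₃^(j+1) = 0`. [cite: BetinaDimitrov2021, Thm 2 (= Thm 4.8 (i)), cases r = 2] -/
theorem mulLeft_m₄_y₃ (j : Fin (n₃ + 1)) : mulLeft X n₂ n₃ (m₄ n₂ n₃) (y₃ n₂ n₃ j) = 0 := by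
  rw [mulLeft_y₃, m₄]; simp

/-- `vec₃ · Y₂^(i+1) = 0`. [cite: BetinaDimitrov2021, Thm 2 (= Thm 4.8 (i)), cases r = 2] -/
theorem mulLeft_vec₃_y₂ (i : Fin (n₂ + 1)) : mulLeft X n₂ n₃ (vec₃ X n₂ n₃) (y₂ n₂ n₃ i) = 0 := by
  rw [mulLeft_y₂, vec₃]
  simp [bmulL_single_last_left]

/-- `vec₃ · Y₃^(j+1) = 0`. [cite: BetinaDimitrov2021, Thm 2 (= Thm 4.8 (i)), cases r = 2] -/
theorem mulLeft_vec₃_y₃ (j : Fin (n₃ + 1)) : mulLeft X n₂ n₃ (vec₃ X n₂ n₃) (y₃ n₂ n₃ j) = 0 := by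
  rw [mulLeft_y₃, vec₃]
  simp [bmulL_single_last_left]

end RingEval

end BDRingB

end Literature.NumberTheory.EllipticCurves.IwasawaTransfer
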